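import Literature.Barriers.CriticalPhenomena.PositionSpaceRGNonGibbsianCore
import Literature.Barriers.CriticalPhenomena.PositionSpaceRGNonGibbsianStep24
import HarnessLib

/-!
# Barrier `PositionSpaceRGNonGibbsian` (van Enter–Fernández–Sokal 1993, Theorem 4.2) — discharged

Final file of the Theorem 4.2 line of
`Literature/Barriers/CriticalPhenomena/PositionSpaceRGNonGibbsian.lean`. The chain of the
companion files is, all arrows proved there,

  `VEFS1993_eq412 ⟹ VEFS1993_eq413 ⟹ VEFS1993_eq432 ⟹ VEFS1993_thm42 ⟺ PositionSpaceRGNonGibbsian`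

(`…Unfixing.lean`: Step 3, the single-site unfixing computation (4.7)–(4.13) and the FKG reduction
to the two extremal boundary conditions; `…FiniteVolume.lean` / `…Spacing.lean`: Step 0, the DLR
transfer to the conditional expectations of `μT₂`; `…Proofs.lean`: (4.32) ⟹ non-quasilocality),
and the only remaining named fact was the uniform gap `VEFS1993_eq412`
(§4.1.2 eqs. (4.12)–(4.13) fed by §4.3.1 Steps 1 and 2). Its three inputs are in the tree:

* `…Diluted.lean`, `eq412_gap_ge_neutral`: by FKG monotonicity in the field, the gap `y - x` of
  `VEFS1993_eq412` is at least `⟨g⟩⁻_{𝔻;Λ^int_{R'};β,h⁰_R}`, the expectation of the gap observable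
  `g = e^{2β∑_{y∼0}σ_y} - e^{-2β∑_{y∼0}σ_y}` in ONE finite-volume system — the internal spins on
  the diluted graph `𝔻 = dilutedGraph d` in the neutralised nonnegative field `h⁰_R`
  (footnote 48) with `-` boundary condition;
* `…Core.lean`, `tendsto_neutral_plus_sub_minus` (§4.3.1 Steps 2.1–2.3 in finite volume:
  uniqueness at the field-carrying sites of the periodic all-`+` image system by convexity of the
  free energy and the GHS inequality, the finite-volume perturbation to `h⁰_R`, and the FKG
  insensitivity trick): `⟨g⟩⁺_{𝔻;Λ^int_{R'};β,h⁰_R} - ⟨g⟩⁻_{𝔻;Λ^int_{R'};β,h⁰_R} → 0` as `R' → ∞`;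
* `…Step24.lean`, `VEFS1993_step24_holds` (§4.3.1 Step 1 with Step 2.4, Griffiths' comparison with
  the `(d-1)`-dimensional model): `⟨σ_{±eᵢ}⟩⁺_{dec;Λ^int_L;β,0} ≥ c(β,d) > 0` for `β > β_c(d-1)`.

Here they are assembled (van Enter–Fernández–Sokal §4.1.2 Step 3, (4.12): "`y - x =
2⟨sinh 2J(σ_{0,1}+σ_{0,-1}+σ_{1,0}+σ_{-1,0})⟩ ≥ 16J⟨σ_{0,1}⟩₊` since the contributions from
`k = 3, 5, …` are all nonnegative by Griffiths' first inequality. Finally, `⟨σ_{0,1}⟩₊` is bounded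
below by a strictly positive constant, uniformly in `R`, so (4.13) … `≥ δ > 0` uniformly in `R`";
§4.3.1 p. 112: "This works for any temperature below the critical temperature of the undiluted
`(d-1)`-dimensional Ising model. We have therefore proven: Theorem 4.2"):

* `fieldExpect_neutral_plus_gapObs_ge` — in the `+` system, lowering the field `h⁰_R ≥ 0` to zero
  (FKG/GKS monotonicity in the field, `g` increasing) gives the zero-field `+` state of `𝔻`, where
  the product expansion of `e^{±2βS}` and Griffiths' first inequality
  (`isingExpect_exp_spinTotal_sub_ge`) give `⟨g⟩⁺ ≥ 2 cosh^{2d-1}(2β) sinh(2β) ⟨σ_{e₁}⟩⁺ ≥ 2κ`,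
  `κ = cosh^{2d-1}(2β) sinh(2β) c`, uniformly in `R, R'`;
* `VEFS1993_eq412_holds` — with `R'` so large that `⟨g⟩⁺ - ⟨g⟩⁻ < κ`:
  `y - x ≥ ⟨g⟩⁻ > ⟨g⟩⁺ - κ ≥ κ`;
* the discharges `VEFS1993_eq413_holds`, `VEFS1993_eq432_holds`, `VEFS1993_thm42_holds` and
  `Literature.Barriers.CriticalPhenomena.PositionSpaceRGNonGibbsian_holds`.

Nothing is asserted: the file is sorry-free and introduces no named fact (D-0014, D-0026).

## References

* A. C. D. van Enter, R. Fernández, A. D. Sokal, *Regularity properties and pathologies of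
  position-space renormalization-group transformations: scope and limitations of Gibbsian
  theory*, J. Stat. Phys. 72 (1993) 879–1167, arXiv:hep-lat/9210032 — Theorem 4.2; §4.1.2 Step 3,
  eqs. (4.7)–(4.13), footnote 48; §4.3.1 Steps 1–3, eqs. (4.26)–(4.32) [VanenterFernandezSokal1993].
* S. Friedli, Y. Velenik, *Statistical Mechanics of Lattice Systems* (CUP 2017), §3.6–§3.8
  (GKS, FKG, GHS) [FriedliVelenik2017].
-/

noncomputable section

open MeasureTheory Finset Filter Topology

namespace Literature.Barriers.CriticalPhenomena.NonGibbs

open Literature.Probability.LatticeModels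

variable {d : ℕ}

/-! ### The decorated lattice of `…Selection.lean` is the diluted graph of `…Diluted.lean` -/

/-- Finite-volume Ising expectations do not depend on the (subsingleton) local-finiteness
structure carried by the graph: equal graphs give equal expectations. [folklore] -/
theorem isingExpect_congr_graph {V : Type*} [DecidableEq V] {G₁ G₂ : SimpleGraph V}
    [h₁ : G₁.LocallyFinite] [h₂ : G₂.LocallyFinite] (hG : G₁ = G₂) (Λ : Finset V) (β h : ℝ)
    (bc : BoundaryCondition V) (f : SpinConfig V → ℝ) :
    isingExpect G₁ Λ β h bc f = isingExpect G₂ Λ β h bc f := by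
  subst hG
  have : h₁ = h₂ := Subsingleton.elim _ _
  subst this
  rfl

variable (d) in
/-- The two transcriptions of the lattice of internal spins in the tree — `decoratedGraph d`
(`…Selection.lean`, VEFS Figure 3 (b)) and `dilutedGraph d` (`…Diluted.lean`, §4.3.1 Step 1,
"periodically diluted lattice") — are the same graph: nearest neighbours of `ℤ^d` neither of which
has all coordinates even. [cite: VanenterFernandezSokal1993, §4.1.2 Step 1 and §4.3.1 Step 1] -/
theorem decoratedGraph_eq_dilutedGraph : decoratedGraph d = dilutedGraph d := rfl

/-- Hence their finite-volume expectations agree. [cite: VanenterFernandezSokal1993, §4.3.1 Step 1] -/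
theorem isingExpect_decorated_eq_diluted (Λ : Finset (Site d)) (β h : ℝ)
    (bc : BoundaryCondition (Site d)) (f : SpinConfig (Site d) → ℝ) :
    isingExpect (decoratedGraph d) Λ β h bc f = isingExpect (dilutedGraph d) Λ β h bc f :=
  isingExpect_congr_graph (decoratedGraph_eq_dilutedGraph d) Λ β h bc f

/-! ### (4.12) in the neutralised `+` system: a lower bound uniform in `R` and `R'` -/

/-- **(4.12) for the neutralised `+` system.** For `β ≥ 0`, `R' ≥ 1`, a neighbour `y₀` of the
origin and a level `c` with `⟨σ_{y₀}⟩⁺_{dec;Λ^int_{R'};β,0} ≥ c` (Step 2.4), the gap observable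
`g = e^{2βS} - e^{-2βS}`, `S = ∑_{y∼0} σ_y`, satisfies
`⟨g⟩⁺_{𝔻;Λ^int_{R'};β,h⁰_R} ≥ 2 cosh^{|N(0)|-1}(2β) sinh(2β) · c`: lowering the nonnegative
neutralised field `h⁰_R` to zero decreases the expectation of the increasing observable `g`
(FKG monotonicity in the field), and in the zero-field `+` state "the contributions from
`k = 3, 5, …` are all nonnegative by Griffiths' first inequality", so
`⟨g⟩⁺ = 2⟨sinh 2βS⟩⁺ ≥ 2 cosh^{|N(0)|-1}(2β) sinh(2β) ⟨σ_{y₀}⟩⁺`.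
[cite: VanenterFernandezSokal1993, §4.1.2 Step 3, eq. (4.12), and §4.3.1 Step 2.4] -/
theorem fieldExpect_neutral_plus_gapObs_ge {β : ℝ} (hβ : 0 ≤ β) (R : ℕ) {R' : ℕ} (hR' : 1 ≤ R')
    {y₀ : Site d} (hy₀ : (zdGraph d).Adj 0 y₀) {c : ℝ}
    (hc : c ≤ isingExpect (decoratedGraph d) (gpiVolume' d R') β 0 .plus (spinAt y₀)) :
    2 * Real.cosh (2 * β) ^ (#((zdGraph d).neighborFinset 0) - 1) * Real.sinh (2 * β) * c ≤
      fieldExpect (dilutedGraph d) (gpiVolume' d R') β (neutralField d R) .plus (gapObs d β) := by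
  set N₀ : Finset (Site d) := (zdGraph d).neighborFinset 0 with hN₀
  have hy₀N : y₀ ∈ N₀ := (SimpleGraph.mem_neighborFinset _ _ _).2 hy₀
  have hN₀sub : N₀ ⊆ gpiVolume' d R' := fun y hy =>
    mem_gpiVolume'_of_adj_zero hR' ((SimpleGraph.mem_neighborFinset _ _ _).1 hy)
  have hK : 0 ≤ 2 * Real.cosh (2 * β) ^ (#N₀ - 1) * Real.sinh (2 * β) :=
    mul_nonneg (mul_nonneg zero_le_two (pow_nonneg (Real.cosh_pos _).le _))
      (Real.sinh_nonneg_iff.2 (by positivity))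
  -- lowering the field `h⁰_R ≥ 0` to `0`: the zero-field `+` state of the diluted graph
  have hfield : fieldExpect (dilutedGraph d) (gpiVolume' d R') β (fun _ => 0) .plus (gapObs d β) ≤
      fieldExpect (dilutedGraph d) (gpiVolume' d R') β (neutralField d R) .plus (gapObs d β) :=
    fieldExpect_mono_field (dilutedGraph d) hβ (h₁ := fun _ => 0) (h₂ := neutralField d R)
      (fun x _ => neutralField_nonneg R x) .plus (gapObs_mono hβ) (measurable_gapObs β)
  rw [fieldExpect_const] at hfield
  -- (4.12) in the zero-field `+` state, by the product expansion and Griffiths' first inequality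
  have hgks := isingExpect_exp_spinTotal_sub_ge (dilutedGraph d) hN₀sub hy₀N hβ
    (by positivity : (0 : ℝ) ≤ 2 * β)
  have hfun : (fun σ => Real.exp (2 * β * spinTotal N₀ σ) - Real.exp (-(2 * β) * spinTotal N₀ σ)) =
      gapObs d β := by
    funext σ
    simp only [gapObs, nbrSpinSum_eq_spinTotal, hN₀, neg_mul]
  rw [hfun] at hgks
  rw [isingExpect_decorated_eq_diluted] at hc
  calc 2 * Real.cosh (2 * β) ^ (#N₀ - 1) * Real.sinh (2 * β) * c
      ≤ 2 * Real.cosh (2 * β) ^ (#N₀ - 1) * Real.sinh (2 * β) *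
          isingExpect (dilutedGraph d) (gpiVolume' d R') β 0 .plus (spinAt y₀) :=
        mul_le_mul_of_nonneg_left hc hK
    _ ≤ isingExpect (dilutedGraph d) (gpiVolume' d R') β 0 .plus (gapObs d β) := hgks
    _ ≤ _ := hfield

/-! ### The uniform gap (4.12)–(4.13): discharge of `VEFS1993_eq412` -/

/-- **Discharge of `VEFS1993_eq412`** (van Enter–Fernández–Sokal §4.1.2 eqs. (4.12)–(4.13) in
dimension `d ≥ 3`, fed by §4.3.1 Steps 1 and 2). For `β > β_c(d-1)` let `c > 0` be the level of
Step 2.4 (`VEFS1993_step24_holds`) and `κ = cosh^{2d-1}(2β) sinh(2β) c`. Given `R`, Step 2 for the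
neutralised system (`tendsto_neutral_plus_sub_minus`) provides `R' > R` with
`⟨g⟩⁺_{h⁰_R} - ⟨g⟩⁻_{h⁰_R} < κ`; then, by the FKG reduction `eq412_gap_ge_neutral` and (4.12)
(`fieldExpect_neutral_plus_gapObs_ge`), `y - x ≥ ⟨g⟩⁻_{h⁰_R} > ⟨g⟩⁺_{h⁰_R} - κ ≥ 2κ - κ = κ`,
uniformly in `R` ("`⟨σ_{0,1}⟩₊` is bounded below by a strictly positive constant, uniformly in
`R`, so … `≥ δ > 0` uniformly in `R`").
[cite: VanenterFernandezSokal1993, §4.1.2 Step 3, eqs. (4.12)–(4.13), and §4.3.1 Steps 1–3, eqs. (4.26)–(4.27)] -/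
theorem VEFS1993_eq412_holds : VEFS1993_eq412 := by
  intro d hd β hβ
  have hβ0 : 0 < β := lt_of_le_of_lt (criticalBeta_nonneg (d - 1)) hβ
  obtain ⟨c, hc, hmag⟩ := VEFS1993_step24_holds d hd β hβ
  -- a neighbour of the origin
  have hd0 : 0 < d := by omega
  set y₀ : Site d := Pi.single ⟨0, hd0⟩ 1 with hy₀
  have hadj₀ : (zdGraph d).Adj 0 y₀ := (zdGraph_adj_zero_iff y₀).2 ⟨⟨0, hd0⟩, Or.inl rfl⟩
  -- the constant of (4.12)
  set K : ℝ := Real.cosh (2 * β) ^ (#((zdGraph d).neighborFinset 0) - 1) * Real.sinh (2 * β)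
    with hK
  have hKpos : 0 < K := mul_pos (pow_pos (Real.cosh_pos _) _) (Real.sinh_pos_iff.2 (by positivity))
  set κ : ℝ := K * c with hκ
  have hκpos : 0 < κ := mul_pos hKpos hc
  refine ⟨κ, hκpos, fun R => ?_⟩
  -- Step 2 for the neutralised system: `⟨g⟩⁺ - ⟨g⟩⁻ < κ` for `R'` large
  obtain ⟨N₁, hN₁⟩ := eventually_atTop.1
    ((tendsto_neutral_plus_sub_minus (d := d) hβ0 R).eventually (gt_mem_nhds hκpos))
  set R' : ℕ := max N₁ (R + 1) with hR'
  have hN₁R' : N₁ ≤ R' := le_max_left _ _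
  have hRR' : R < R' := lt_of_lt_of_le (Nat.lt_succ_self R) (le_max_right _ _)
  have hR'1 : 1 ≤ R' := le_trans (by omega) (le_max_right _ _)
  refine ⟨R', hRR', ?_⟩
  have hsel := hN₁ R' hN₁R'
  -- the FKG reduction to the neutralised `-` system and (4.12) in the neutralised `+` system
  have hred := eq412_gap_ge_neutral (d := d) hβ0.le hRR'
  have hlow := fieldExpect_neutral_plus_gapObs_ge hβ0.le R hR'1 hadj₀ (hmag y₀ hadj₀ R')
  have h2κ : 2 * κ = 2 * Real.cosh (2 * β) ^ (#((zdGraph d).neighborFinset 0) - 1) *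
      Real.sinh (2 * β) * c := by
    rw [hκ, hK]; ring
  rw [← h2κ] at hlow
  change fieldExpect (dilutedGraph d) (gpiVolume' d R') β (neutralField d R) .minus (gapObs d β) ≤ _
    at hred
  linarith

/-- **Discharge of `VEFS1993_eq413`** (§4.3.1 Steps 2–3 in the uniform finite-volume form of
§4.2 Step 2), through the proved Step 3 `VEFS1993_eq413_of_eq412`.
[cite: VanenterFernandezSokal1993, §4.3.1 Steps 2–3, eqs. (4.26)–(4.27), and §4.1.2 eq. (4.13)] -/
theorem VEFS1993_eq413_holds : VEFS1993_eq413 :=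
  VEFS1993_eq413_of_eq412 VEFS1993_eq412_holds

/-- **Discharge of `VEFS1993_eq432`** (the two-sided a.e. estimate (4.32) on the conditional
expectation of the image spin at the origin), through the proved Step 0
`VEFS1993_eq432_of_eq413`. [cite: VanenterFernandezSokal1993, §4.3.1 eq. (4.32)] -/
theorem VEFS1993_eq432_holds : VEFS1993_eq432 :=
  VEFS1993_eq432_of_eq412 VEFS1993_eq412_holds

/-- **van Enter–Fernández–Sokal 1993, Theorem 4.2 — proved** (as transcribed for `d ≥ 3`): for
every `β > β_c(d-1)` and every infinite-volume Gibbs measure `μ` of the `d`-dimensional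
nearest-neighbour Ising model at `(β, 0)`, the decimated measure `μT₂` is not consistent with any
quasilocal specification. [cite: VanenterFernandezSokal1993, Theorem 4.2] -/
theorem VEFS1993_thm42_holds : VEFS1993_thm42 :=
  VEFS1993_thm42_of_eq412 VEFS1993_eq412_holds

end Literature.Barriers.CriticalPhenomena.NonGibbs

namespace Literature.Barriers.CriticalPhenomena

/-- **The barrier `PositionSpaceRGNonGibbsian` holds**: the `b = 2` decimation of the
low-temperature (`β > β_c(d-1)`, `d ≥ 3`) zero-field nearest-neighbour Ising Gibbs measures on
`ℤ^d` is non-Gibbsian (van Enter–Fernández–Sokal 1993, Theorem 4.2, the Griffiths–Pearce–Israel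
scenario made rigorous), so position-space RG maps of this class do not act on Hamiltonians there.
[cite: VanenterFernandezSokal1993, Theorem 4.2] -/
theorem PositionSpaceRGNonGibbsian_holds : PositionSpaceRGNonGibbsian :=
  positionSpaceRGNonGibbsian_iff.2 NonGibbs.VEFS1993_thm42_holds

/-- In particular, at `d = 3`: for every `β > β_c(2) = ½ log(1+√2)` the `b = 2` decimation step is
not a map on Hamiltonians at `(β, 0)` for the nearest-neighbour Ising model on `ℤ³`.
[cite: VanenterFernandezSokal1993, Theorem 4.2 and Definition 3.1] -/
theorem not_renormalizedHamiltonianExists_decimate_three {β : ℝ}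
    (hβ : Literature.Probability.LatticeModels.criticalBeta 2 < β) :
    ¬ NonGibbs.RenormalizedHamiltonianExists 3 (NonGibbs.decimate 3 2) β 0 :=
  PositionSpaceRGNonGibbsian_holds.dim_three hβ

end Literature.Barriers.CriticalPhenomena

end
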